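import Summits.AnomalousDissipation.AnomalousDissipation.Theses.MomentParity
import Summits.AnomalousDissipation.AnomalousDissipation.Theorems.QuarticGate.Negative.EnergyRow
import Summits.AnomalousDissipation.AnomalousDissipation.Theorems.MomentParityResolvedDissipationStubTightExtraction
import Summits.AnomalousDissipation.AnomalousDissipation.Theorems.MomentParityResolvedDissipationStubLimitSSS
import Summits.AnomalousDissipation.AnomalousDissipation.Theorems.MomentParityResolvedDissipationStubSchedule
import Summits.AnomalousDissipation.AnomalousDissipation.Theorems.MomentParityResolvedDissipationStubStressEnergyEq
import Summits.AnomalousDissipation.AnomalousDissipation.Theorems.MomentParityResolvedDissipationStubDominatedFluxEnergyEq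
import Summits.AnomalousDissipation.AnomalousDissipation.Theorems.MomentParityResolvedDissipationStubContinuousFlux
import Literature.Analysis.FluidPDE.StatisticalSolutionEnergyEq
import Literature.Analysis.FluidPDE.SteadyNavierStokesEnergy
import Literature.Analysis.FluidPDE.EnergySpaceRellich
import Literature.Analysis.FluidPDE.CylindricalGenerator

/-!
# Line `lions-l4-domination` for crux `MomentParity.ResolvedDissipation` (stmt-AnomalousDissipation-14284)
# — the LEAD's skeleton v4 (prover-line-stmt-AnomalousDissipation-14284-c1-0, 2026-08-16T14:00Z)
#
# v1 (10:36Z) = the planner's CHECKED SKELETON verbatim (5 stubs). v2 (13:05Z): wave 1 LANDED four of them —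
# K2a `stub_tightExtraction` (p97367, `…StubTightExtraction.lean`), K2b `stub_limitIsStationarySolution`
# (p103380, `…StubLimitSSS.lean` + Prep p100136 + Shell p101468), K2c `stub_scheduleOfLimitEnergyEq` (p97361,
# `…StubSchedule.lean`), P1 `stub_energyEq_of_stressMoment` (p98300, `…StubStressEnergyEq.lean`) — imported
# below. v3 (this file) RESHAPES THE HARD STUB into the flux currency the transfer actually consumes:
#   * K1 (`N`-uniform second moment of ‖B(u,u)‖_{V′}, budget 3/2 via ‖u‖⁴_{L⁴}) is DEMOTED to the hypothesis of
#     the sorry-free conditional `resolvedAt_of_uniformStressMoment` (the v2 composition at fixed `(f, ν, R)`, kept);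
#   * K1′ `stub_uniformMaximalFlux` (NEW HARD STUB, held by the lead): an `N`-uniform FIRST moment of the
#     MAXIMAL ENERGY FLUX `Π*(u) = sup_m |∫(u⊗u):∇P_m u|` over admissible laws — budget 1 (the flux itself,
#     whose signed mean is the dissipation budget for free), implied by K1 (`Π* ≤ ‖B‖_{V′}‖∇u‖₂`, Cauchy–Schwarz
#     + energy row), still sufficient;
#   * P1′ `stub_energyEq_of_dominatedFlux` (wave 2): SSS + `f ∈ L²` + ONE integrable function dominating every
#     Galerkin flux `|∫(u⊗u):∇P_m u|` a.e. ⇒ mean energy EQUALITY (dominated convergence in the 2-D proof; no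
#     scaling, no Sobolev);
#   * L′ `stub_continuous_flux` (wave 2): each flux `u ↦ ∫(u⊗u):∇P_m u` is norm-continuous on `H`, so `Π*` is
#     lower semicontinuous and K1′ passes to Galerkin limits by K2a's lsc portmanteau.
# v4: wave 2 LANDED P1′ `stub_energyEq_of_dominatedFlux` (p106498, `…StubDominatedFluxEnergyEq.lean`) and L′
# `stub_continuous_flux` (p106968, `…StubContinuousFlux.lean`) — imported below. ONE sorry left: K1′ (hard).
# `ResolvedDissipation_of` = budget → K2a → K2b → (L′ + lsc clause + K1′ ⇒ ∫Π* dμ_∞ < ∞) → P1′ → K2c.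
# LANDED COMPANIONS (all `--supports` this crux, sorry-free): `Theorems/MomentParityResolvedDissipationEquivalently.lean`
# (p107240: `resolvedDissipation_iff_galerkinLimitEnergyEq` — the crux ⟺ mean energy EQUALITY of Galerkin-limit SSS in a
# common ball, over K2a/K2b/K2c), `…FluxDecay.lean` (p108740: `resolvedAt_iff_uniformFluxDecay` — resolved at (f,ν,R) ⟺
# sup_{N,μ} |E_μ Π_m| → 0, the crux in the flux currency of K1′), `…MaxFluxOfStress.lean` (p108387:
# `uniformMaximalFlux_of_uniformStressMoment` — K1 ⇒ K1′, the reshape is a weakening), `…SmallDataMaxFlux.lean` (p108019: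
# `uniformMaximalFlux_smallForce` — K1′ HOLDS in the laminar regime ∫‖f‖² ≤ ν⁴/16, C = ½(∫‖f‖²+ν²)+ν³).

Idea card `Cruxes/ResolvedDissipation/Ideas/lions-l4-domination.md` (crux-ideate r1, ideator 2);
line card `Cruxes/ResolvedDissipation/Lines/lions-l4-domination.md`.

THE CRUX (fixed, rank 5 of route MomentParity): for every smooth divergence-free mean-zero force `f`,
every `ν > 0` and every radius `R` there is ONE schedule `κ : ℕ → ℕ` such that every Borel probability
law on `H = L²_σ(T³)` carried by level-`N` Fourier–Galerkin fields, supported in `‖u‖ ≤ R` and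
stationary for Galerkin NS at `(ν, f)` against all polynomial cylindrical band-limited observables
("admissible law at level `N`"), has `κ`-resolved mean enstrophy
`∫‖∇u‖² dμ ≤ ∫‖∇P_{κ n}u‖² dμ + 1/(n+1)` — uniformly in `N` (Disproof §3: `∀ N ∃ κ` is free).

THE LINE (compactness + a new 3-D conditional energy equality, in the REYNOLDS-STRESS currency).
`¬RD` produces a leaking sequence of admissible laws at levels `N_i → ∞`; such a sequence is tight in
the NORM topology of `H` (energy row `ν∫‖∇u‖² = ∫(f,u) ≤ ‖f‖R` + Rellich), every subsequential limit
is a Foias–Prodi stationary statistical solution (SSS) of 3-D NS at `(ν, f)` in the tree's sense, and a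
limit satisfying the mean energy EQUALITY `ν∫‖∇u‖² dμ_∞ = ∫(f,u) dμ_∞` contradicts the leak. The
energy equality of the limit is Lions' theorem made statistical: it holds as soon as the second moment
of the `V′`-norm of the inertial force `B(u,u) = P_σ∇·(u⊗u)` is finite,
`∫ ‖B(u,u)‖²_{V′} dμ_∞ < ∞` (domination `|b(u,u,P_m u)| ≤ ‖B(u,u)‖_{V′}‖∇P_m u‖`, replacing the
Ladyzhenskaya step of the tree's 2-D proof `IsStationaryStatisticalSolution.energy_eq_holds`), and that
moment is lower semicontinuous on `(H, norm)`, so ONE `N`-uniform a-priori bound on it over admissible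
laws (the hard stub, C⁺ of the card in the `V′` form demanded by triage r1-1/r1-3) passes to every limit.
Here `‖B(u,u)‖_{V′} := sup {|∫(u⊗u):∇w| : w smooth, div-free, mean-zero, ‖∇w‖₂ ≤ 1}` is written with
the tree's `Torus.inertialPairing` (no new definition); `‖B(u,u)‖_{V′} ≤ ‖u‖²_{L⁴}`, so any `N`-uniform
fourth `L⁴`-moment bound (the card's original K1, Lions' `L⁴L⁴` class) implies the hard stub.

STUBS OF v1 (5) AND THE v1–v2 COMPOSITION (kept below as `resolvedAt_of_uniformStressMoment`; v3/v4's changes are in the banner above).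
* `stub_uniformStressMoment`   (K1, THE HARD ONE, XL): `N`-uniform bound `∫‖B(u,u)‖²_{V′}dμ ≤ C(f,ν,R)`
  over admissible laws.
* `stub_energyEq_of_stressMoment` (P1, M): SSS on `T³` + `f ∈ L²` + finite stress moment ⇒ mean energy
  EQUALITY (Literature-grade `d = 3` companion of the vendored `energy_eq`, any real `ν`).
* `stub_tightExtraction`       (K2a, L): Rellich–Prokhorov extraction on `H`: probability laws a.e. in the
  ball `‖u‖ ≤ R` with uniformly bounded mean enstrophy have a subsequence converging to a probability law
  a.e. in the ball — bounded-continuous convergence, lsc-portmanteau for `[0,∞]`-valued lsc functionals,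
  continuity of truncated enstrophies and of `L²`-pairings (pure measure theory on `H`, no dynamics).
* `stub_limitIsStationarySolution` (K2b, L): a limit (in that sense) of admissible laws at levels `N_i → ∞`
  is an SSS of NS at `(ν, f)` (finite enstrophy by lsc; Liouville rows pass with `P_{N_i}g → g` and the
  `C¹`-density of polynomial profiles on the compact carrier; shell inequality (1.31) from the level-`N`
  shell energy rows + lsc).
* `stub_scheduleOfLimitEnergyEq` (K2c, M): the leak contradiction — if every admissible sequence with
  levels `→ ∞` has a subsequential limit with finite enstrophy, energy EQUALITY and continuity of the
  injection `∫(f,u)` and of every truncated enstrophy `∫‖∇P_K u‖²`, then ONE schedule resolves every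
  admissible law (monotonicity of `K ↦ ∫‖∇P_K u‖²`, energy row at each level, monotone convergence).
* `ResolvedDissipation_of : ResolvedDissipation` — concludes the route decl BY NAME, consuming K1, P1,
  K2a, K2b, K2c (direct style of all accepted `Lines/`); kernel-checked glue, no `sorry` of its own
  (axioms of the two proved helpers: propext, Classical.choice, Quot.sound): the `N`-uniform enstrophy budget `∫‖∇u‖² dμ ≤ ‖f‖₂R/ν` (energy row of the landed
  `Theorems/QuarticGate/Negative/EnergyRow`, PROVED here as `ensembleEnstrophy_le_budget`) feeds K2a; K2b
  makes the limit an SSS; the stress functional is PROVED lower semicontinuous on `H`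
  (`lowerSemicontinuous_stressSq`, from `Torus.continuous_inertialPairing_coe`), so K2a's lsc clause and
  K1 bound its moment under the limit; P1 gives the energy equality; K2c returns `κ`; the crux's verbatim
  clauses are the landed vocabulary `IsLevel / IsBandTest / polyGrad / IsPolyStationary`
  (`Theorems/QuarticGate/Negative/LevelCeiling`, definitional) with `∀ d, IsPolyStationary ν f N d μ`.

STYLE. Every stub is stated over TREE VOCABULARY ONLY (no local `def`, no notation; the stress functional
is an inline `⨆` over `Torus.inertialPairing`), so each lands verbatim as
`Theorems/MomentParityResolvedDissipation<Stub>.lean --supports stmt-AnomalousDissipation-14284`; K2a has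
no dynamics and K2b/K2c no stress functional, so they serve every line of this crux (triage merge advice).

DISPROOF USED (`Cruxes/ResolvedDissipation/Disproof.lean`, cdisprove cycle 1, re-read 2026-08-16T05:40Z, NO KILL;
companion `WhyItResists.md`: its Step 1 CAUTION — generator rows are not WEAKLY continuous — is answered by
K2a's NORM tightness):
`resolvedDissipation_false_without_nu_pos` — `0 < ν` enters `ensembleEnstrophy_le_budget` (tightness
constant `‖f‖R/ν`, hypothesis of K2a via the glue), K2b ((1.31) by lsc needs `ν > 0`) and K2c
(`E_i = ∫(f,u)dμ_i/ν`); `_false_without_stationarity` — the energy row (glue, K2c), the full Liouville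
class (K2b) and the dynamics behind K1; `_false_without_level` — K2b (`P_N g` versus `g` on the carrier,
`b(u,u,P_N u) = 0` on level-`N` fields) and K2c (an unresolved law at cutoff `K` lives at level `N > K`,
so leaking levels escape to infinity); §3 (quantifier order) — K2c outputs one `κ` for all `N` by
compactness; §4 (`not_resolvedDissipationUniformInForce`) — every constant carries `‖f‖₂` (budget, `C`).
No `-- Targets` / landed `Negative/` lemma exists for this crux yet (nothing to check stubs against).
-/

noncomputable section

-- `Summit.<Summit>.<Problem>`: single-conjunct summit, the duplicate namespace segment is mandated.
set_option linter.dupNamespace false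

namespace Summit.AnomalousDissipation.AnomalousDissipation.Cruxes.ResolvedDissipation.LionsL4Domination

open MeasureTheory Filter Topology
open scoped ENNReal NNReal InnerProductSpace RealInnerProductSpace
open Literature.Analysis.FunctionSpaces Literature.Analysis.FluidPDE
open Summit.AnomalousDissipation.AnomalousDissipation.Theses.MomentParity
open Summit.AnomalousDissipation.AnomalousDissipation.Theorems.QuarticGate.Negative

/-! ## K1′ — the hard stub (v3): an `N`-uniform mean MAXIMAL ENERGY FLUX -/

/-- **K1′ `stub_uniformMaximalFlux` (THE HARD STUB of v3, XL; held by the lead).** For every smooth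
divergence-free mean-zero force `f`, every `ν > 0` and every `R` there is `C = C(f, ν, R)` such that EVERY
admissible law `μ` (probability, level-`N` carried, supported in `‖u‖ ≤ R`, stationary for Galerkin NS at
`(ν, f)` against all polynomial cylindrical band-limited observables), at EVERY level `N`, has
`∫ Π*(u) dμ ≤ C`, where `Π*(u) := sup_m |Π_m(u)|`, `Π_m(u) = ∫ (u⊗u):∇P_m u = Torus.inertialPairing u (P_m u)`
is the instantaneous energy flux OUT of the modes `|k| ≤ m` (on level-`N` fields `Π_m = −∫(u⊗u):∇Q_m u`,
and `Π_m = 0` for `m ≥ N`). CURRENCY: budget 1 — the SIGNED mean flux is free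
(`E_μ Π_m = ν E_μ‖∇Q_m u‖² − E_μ(f, Q_m u) ∈ [−‖f‖₂R, ‖f‖₂R]` by the high-mode energy row), RD itself is
`sup_{N,μ} E_μ Π_m → 0` (`m → ∞`), and K1′ asks for the mean of the MAXIMAL absolute flux; it is implied by
the v2 stub K1 (`Π* ≤ ‖B(u,u)‖_{V′}‖∇u‖₂`, Cauchy–Schwarz, energy row) and implies RD through P1′ + K2a–c.
Known corners: Diracs at Galerkin steady states and laminar families (`N`-uniform `H²`), small Grashof,
`d = 2`. WHY IT MIGHT FAIL: a maximal inequality over scales on top of an a-priori bound at the energy-flux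
budget — open; `¬RD ⇒ ¬K1′` along the leaking sequence (it is ≥ the crux, better aimed, not cheaper).
[difficulty: XL] -/
theorem stub_uniformMaximalFlux :
    ∀ f : UnitAddTorus (Fin 3) → EuclideanSpace ℝ (Fin 3),
      Torus.IsSmooth f → Torus.IsDivFree f → Torus.HasZeroMean f →
    ∀ ν : ℝ, 0 < ν → ∀ R : ℝ, ∃ C : ℝ≥0,
    ∀ (N : ℕ) (μ : Measure (Torus.energySpace (Fin 3))), IsProbabilityMeasure μ →
      (∀ᵐ u ∂μ, IsLevel N u) → (∀ᵐ u ∂μ, ‖u‖ ≤ R) → (∀ d : ℕ, IsPolyStationary ν f N d μ) →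
      ∫⁻ u, (⨆ m : ℕ, ‖Torus.inertialPairing u.1 (Torus.fourierTruncate m
          (u.1 : UnitAddTorus (Fin 3) → EuclideanSpace ℝ (Fin 3)))‖ₑ) ∂μ ≤ C := by
  sorry

/-! ## P1′ — mean energy EQUALITY from ONE integrable dominating function for the Galerkin fluxes -/

/-- **P1′ `stub_energyEq_of_dominatedFlux` (M; Literature-grade, the `d = 3` conditional companion of the
vendored `Torus.IsStationaryStatisticalSolution.energy_eq`).** A stationary statistical solution `μ` of NS
on `T³` at `(ν, f)`, `f ∈ L²`, whose Galerkin energy fluxes `Π_m(u) = ∫ (u⊗u):∇P_m u` are dominated, for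
`μ`-a.e. `u` and every `m`, by ONE `μ`-integrable function `g`, satisfies the mean energy EQUALITY
`ν ∫‖∇u‖² dμ = ∫ (u,f) dμ` (every real `ν`). PROOF PLAN: the 2-D proof `energy_eq_holds`
(`StatisticalSolutionEnergyEq`: Liouville tested on `galerkinTest m ha`, `integral_galerkinBalance_eq_zero`,
`m → ∞` then `a → ∞` by dominated convergence) with its two `d = 2` steps swapped: the domination of
`w(|P_m u|²/a) Π_m(u)` is `C_w g` (hypothesis), and the pointwise limit `Π_m(u) → 0` for `μ`-a.e. `u` is
`tendsto_inertialPairing_fourierTruncate_of_card_le_four` (finite enstrophy a.e., `H¹ ⊂ L⁴` in `d ≤ 4`).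
[difficulty: M] -/
theorem stub_energyEq_of_dominatedFlux :
    ∀ (ν : ℝ) (f : UnitAddTorus (Fin 3) → EuclideanSpace ℝ (Fin 3))
      (μ : Measure (Torus.energySpace (Fin 3))),
      Torus.IsStationaryStatisticalSolution ν f μ → MemLp f 2 volume →
      (∃ g : Torus.energySpace (Fin 3) → ℝ, Integrable g μ ∧
        ∀ m : ℕ, ∀ᵐ u ∂μ, |Torus.inertialPairing u.1 (Torus.fourierTruncate m
          (u.1 : UnitAddTorus (Fin 3) → EuclideanSpace ℝ (Fin 3)))| ≤ g u) →
      ν * (Torus.ensembleEnstrophy μ).toReal = ∫ u, Torus.pairing u.1 f ∂μ :=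
  Summit.AnomalousDissipation.AnomalousDissipation.Theorems.MomentParityResolvedDissipation.DominatedFluxEnergyEq.stub_energyEq_of_dominatedFlux

/-! ## L′ — the Galerkin fluxes are norm-continuous on `H` -/

/-- **L′ `stub_continuous_flux` (M; folklore).** For every cutoff `m`, the energy flux
`u ↦ Π_m(u) = ∫ ⟪∇(P_m u)(x) u(x), u(x)⟫ dx` is continuous on `H` (norm topology): `P_m u` is a real
trigonometric polynomial whose finitely many coefficients are continuous linear functionals of `u`, its
gradient is bounded in sup norm by `Σ_{|k|≤m} 2π|k| ‖û(k)‖` (`Torus.norm_fderiv_fourierTruncate_apply_le` /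
`truncDerivBound`), and `|∫⟪∇w u, u⟫ − ∫⟪∇w v, v⟫| ≤ ‖∇w‖_∞ (‖u‖ + ‖v‖)‖u − v‖`,
`|∫⟪∇(w − w′) v, v⟫| ≤ ‖∇(w − w′)‖_∞ ‖v‖²`. Consequence used below: the maximal flux
`Π* = ⨆_m ‖Π_m‖ₑ` is lower semicontinuous on `H`. [difficulty: M] -/
theorem stub_continuous_flux :
    ∀ m : ℕ, Continuous fun u : Torus.energySpace (Fin 3) =>
      Torus.inertialPairing u.1 (Torus.fourierTruncate m
        (u.1 : UnitAddTorus (Fin 3) → EuclideanSpace ℝ (Fin 3))) :=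
  Summit.AnomalousDissipation.AnomalousDissipation.Theorems.MomentParityResolvedDissipation.ContinuousFlux.stub_continuous_flux

/-! ## K1 (v1–v2 hard stub) is now the HYPOTHESIS `hC` of `resolvedAt_of_uniformStressMoment` below -/

/-! ## P1 — the 3-D conditional mean energy EQUALITY for stationary statistical solutions -/

/-- **P1 `stub_energyEq_of_stressMoment` (M; Literature-grade by-product, the `d = 3` companion of the
vendored `Torus.IsStationaryStatisticalSolution.energy_eq`, FMRT IV Thm 2.2 / App. B.1).** A stationary
statistical solution `μ` of NS on `T³` at `(ν, f)`, `f ∈ L²`, whose inertial force has finite second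
`V′`-moment, `∫ ‖B(u,u)‖²_{V′} dμ < ∞`, satisfies the mean energy EQUALITY `ν ∫‖∇u‖² dμ = ∫ (f,u) dμ`
(for every real `ν`, like the tree's 2-D proof). PROOF PLAN: run `energy_eq_holds`
(`StatisticalSolutionEnergyEq`: Liouville tested on `galerkinTest m ha`, `integral_galerkinBalance_eq_zero`,
`m → ∞` then `a → ∞` by dominated convergence) with step 4 replaced by the domination
`|inertialPairing u (P_m u)| ≤ ‖B(u,u)‖_{V′} ‖∇P_m u‖₂ ≤ ½(‖B(u,u)‖²_{V′} + ‖∇u‖²) ∈ L¹(μ)` (scaling in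
the definition of the sup: `P_m u ∈ 𝒱`; `eGradNormSq_fourierTruncate_le`) and the pointwise limit
`inertialPairing u (P_m u) → 0` for `μ`-a.e. `u` (finite enstrophy:
`tendsto_inertialPairing_fourierTruncate_of_card_le_four`, `SteadyNavierStokesEnergy`). Lions' `L⁴L⁴`
class is the special case `‖B(u,u)‖_{V′} ≤ ‖u‖²_{L⁴}`. [difficulty: M] -/
theorem stub_energyEq_of_stressMoment :
    ∀ (ν : ℝ) (f : UnitAddTorus (Fin 3) → EuclideanSpace ℝ (Fin 3))
      (μ : Measure (Torus.energySpace (Fin 3))),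
      Torus.IsStationaryStatisticalSolution ν f μ → MemLp f 2 volume →
      ∫⁻ u, (⨆ (w : UnitAddTorus (Fin 3) → EuclideanSpace ℝ (Fin 3))
          (_ : Torus.IsSmooth w ∧ Torus.IsDivFree w ∧ Torus.HasZeroMean w ∧ Torus.eGradNormSq w ≤ 1),
          ‖Torus.inertialPairing u.1 w‖ₑ) ^ 2 ∂μ ≠ ⊤ →
      ν * (Torus.ensembleEnstrophy μ).toReal = ∫ u, Torus.pairing u.1 f ∂μ :=
  Summit.AnomalousDissipation.AnomalousDissipation.Theorems.MomentParityResolvedDissipation.StressEnergyEq.stub_energyEq_of_stressMoment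

/-! ## K2a — Rellich–Prokhorov extraction on `H` -/

/-- **K2a `stub_tightExtraction` (L; pure measure theory on `H`, reusable by `UniformResolution` 14330,
`GalerkinEnsembleRealization` 11466 and route Ensemble).** A sequence of Borel probability laws on
`H = L²_σ(T³)` supported in the ball `‖u‖ ≤ R` with uniformly bounded mean enstrophy `∫‖∇u‖² dμ_i ≤ M`
is TIGHT IN THE NORM TOPOLOGY of `H` (Chebyshev + Rellich `Torus.isCompact_setOf_eGradNormSq_le`,
`EnergySpaceRellich`), hence (Prokhorov, Mathlib `isCompact_closure_of_isTightMeasureSet`; `H` is a closed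
subspace of the separable Hilbert space `L²(T³;ℝ³)`, so `ProbabilityMeasure H` is metrisable by
Lévy–Prokhorov) has a subsequence converging weakly to a probability law `μ_∞`, which is again carried by
the closed ball (portmanteau), with: convergence of `∫ g` for bounded continuous `g : H → ℝ`; the lsc
portmanteau `∫ G dμ_∞ ≤ liminf ∫ G dμ_{φ i}` for every lower semicontinuous `G : H → [0,∞]` (monotone
approximation by bounded Lipschitz functions); and, as bounded-continuous-on-the-ball instances,
convergence of every truncated enstrophy `∫ ‖∇P_K u‖² dμ` (`u ↦ ‖∇P_K u‖²` is a finite sum of continuous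
Fourier modes, `≤ 4π²K²R²` on the ball) and of every pairing `∫ (u, f) dμ`, `f ∈ L²`
(`Torus.continuous_pairing_coe`, `≤ ‖f‖₂R` on the ball). [difficulty: L] -/
theorem stub_tightExtraction :
    ∀ (R : ℝ) (M : ℝ≥0) (μ : ℕ → Measure (Torus.energySpace (Fin 3))),
      (∀ i, IsProbabilityMeasure (μ i)) → (∀ i, ∀ᵐ u ∂(μ i), ‖u‖ ≤ R) →
      (∀ i, Torus.ensembleEnstrophy (μ i) ≤ M) →
      ∃ φ : ℕ → ℕ, StrictMono φ ∧ ∃ μlim : Measure (Torus.energySpace (Fin 3)),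
        IsProbabilityMeasure μlim ∧ (∀ᵐ u ∂μlim, ‖u‖ ≤ R) ∧
        (∀ g : Torus.energySpace (Fin 3) → ℝ, Continuous g → (∃ B : ℝ, ∀ u, |g u| ≤ B) →
          Tendsto (fun i => ∫ u, g u ∂(μ (φ i))) atTop (𝓝 (∫ u, g u ∂μlim))) ∧
        (∀ G : Torus.energySpace (Fin 3) → ℝ≥0∞, LowerSemicontinuous G →
          ∫⁻ u, G u ∂μlim ≤ Filter.liminf (fun i => ∫⁻ u, G u ∂(μ (φ i))) atTop) ∧
        (∀ K : ℕ, Tendsto (fun i => ∫⁻ u, Torus.eGradNormSq (Torus.fourierTruncate K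
            (u.1 : UnitAddTorus (Fin 3) → EuclideanSpace ℝ (Fin 3))) ∂(μ (φ i))) atTop
          (𝓝 (∫⁻ u, Torus.eGradNormSq (Torus.fourierTruncate K
            (u.1 : UnitAddTorus (Fin 3) → EuclideanSpace ℝ (Fin 3))) ∂μlim))) ∧
        (∀ f : UnitAddTorus (Fin 3) → EuclideanSpace ℝ (Fin 3), MemLp f 2 volume →
          Tendsto (fun i => ∫ u, Torus.pairing u.1 f ∂(μ (φ i))) atTop
            (𝓝 (∫ u, Torus.pairing u.1 f ∂μlim))) :=
  Summit.AnomalousDissipation.AnomalousDissipation.Theorems.MomentParityResolvedDissipation.TightExtraction.stub_tightExtraction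

/-! ## K2b — Galerkin limits of admissible laws are stationary statistical solutions -/

/-- **K2b `stub_limitIsStationarySolution` (L; = card 1's `GalerkinLimitIsSSS`, triage: "one
`--supports` file for all lines").** Let `μ_i` be admissible laws at levels `N_i → ∞` (same `ν > 0`,
`f ∈ L²`, ball `R`) converging to a probability law `μ_∞` carried by the ball in the sense of K2a
(bounded-continuous convergence and the lsc portmanteau). Then `μ_∞` is a stationary statistical solution
of NS at `(ν, f)` in the tree's sense (`Torus.IsStationaryStatisticalSolution`, FMRT IV Def. 1.3):
(1.29) finite mean enstrophy — `u ↦ ‖∇u‖²` is lsc on `H` (`Torus.lowerSemicontinuous_eGradNormSq_coe`)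
and `∫‖∇u‖² dμ_i ≤ ‖f‖₂R/ν` (energy row, `ensembleDissipation_eq_of_polyStationary`); (1.30) the Liouville
identity for every cylindrical test `Φ` (smooth `gⱼ`, `C¹` compactly supported `φ`): at level `N_i` the
row of `(P_{N_i}gⱼ)ⱼ` (band tests: `isDivFree_fourierTruncate`, zero mode) with a POLYNOMIAL profile
vanishes exactly; on the carrier `(u, P_N g) = (u, g)`, `(u, ΔP_N g) = (u, Δg)`, while
`|(f, g − P_N g)| + |∫(u⊗u):∇(g − P_N g)| ≤ ‖f‖₂‖g − P_N g‖₂ + R²‖∇(g − P_N g)‖_∞ → 0`; polynomial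
profiles are `C¹`-dense on the compact range of the coordinates (Bernstein/Nachbin), every row is
norm-continuous on `H` (`Torus.continuous_nsGeneratorPairing_grad`, `CylindricalGenerator`) and bounded
on the ball, so it passes to the limit; (1.31) on sharp shells `{e₁ ≤ |u|² < e₂}`: at level `N_i` the
shell energy rows `∫ ψ(|u|²)[(f,u) − ν‖∇u‖²] dμ_i = 0` hold for polynomial (hence continuous) `ψ ≥ 0`
(observable `ρ(Σ_a (u,e_a)²)` over the Galerkin frame, `nsGeneratorPairing_energy_of_isLevel`,
`inertialPairing_fourierTruncate_of_isLevel`), the `(f,u)ψ` part converges and the `ν‖∇u‖²ψ` part is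
lsc (`ν > 0`), then `ψ_n → 1_{[e₁,e₂)}` pointwise boundedly under `μ_∞` (dominated convergence).
[difficulty: L] -/
theorem stub_limitIsStationarySolution :
    ∀ (ν : ℝ) (f : UnitAddTorus (Fin 3) → EuclideanSpace ℝ (Fin 3)) (R : ℝ), 0 < ν → MemLp f 2 volume →
    ∀ (Nl : ℕ → ℕ) (μ : ℕ → Measure (Torus.energySpace (Fin 3))),
      (∀ i, IsProbabilityMeasure (μ i)) → (∀ i, ∀ᵐ u ∂(μ i), IsLevel (Nl i) u) →
      (∀ i, ∀ᵐ u ∂(μ i), ‖u‖ ≤ R) → (∀ i (d : ℕ), IsPolyStationary ν f (Nl i) d (μ i)) →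
      Tendsto Nl atTop atTop →
    ∀ μlim : Measure (Torus.energySpace (Fin 3)), IsProbabilityMeasure μlim → (∀ᵐ u ∂μlim, ‖u‖ ≤ R) →
      (∀ g : Torus.energySpace (Fin 3) → ℝ, Continuous g → (∃ B : ℝ, ∀ u, |g u| ≤ B) →
          Tendsto (fun i => ∫ u, g u ∂(μ i)) atTop (𝓝 (∫ u, g u ∂μlim))) →
      (∀ G : Torus.energySpace (Fin 3) → ℝ≥0∞, LowerSemicontinuous G →
          ∫⁻ u, G u ∂μlim ≤ Filter.liminf (fun i => ∫⁻ u, G u ∂(μ i)) atTop) →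
      Torus.IsStationaryStatisticalSolution ν f μlim :=
  Summit.AnomalousDissipation.AnomalousDissipation.Theorems.MomentParityResolvedDissipation.LimitSSS.stub_limitIsStationarySolution

/-! ## K2c — the leak contradiction: energy equality of all Galerkin limits ⟹ one schedule -/

/-- **K2c `stub_scheduleOfLimitEnergyEq` (M; real analysis + the level-`N` energy row; = card 1's
`FirstLemmaA ⟸`, triage E2).** Fix `ν > 0`, `f ∈ L²`, `R`. Suppose every sequence of admissible laws
`μ_i` at levels `N_i → ∞` admits a subsequence `φ` and a law `μ_∞` with FINITE mean enstrophy, the mean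
energy EQUALITY `ν∫‖∇u‖²dμ_∞ = ∫(f,u)dμ_∞`, `∫(f,u)dμ_{φ i} → ∫(f,u)dμ_∞`, and
`∫‖∇P_K u‖²dμ_{φ i} → ∫‖∇P_K u‖²dμ_∞` for every `K`. Then ONE schedule `κ` resolves every admissible
law at every level. PROOF PLAN (contradiction, the kill shape of Disproof §5): otherwise some tolerance
`δ = 1/(n+1)` and, for every cutoff `K`, an admissible `μ_K` at level `N_K` with
`∫‖∇u‖² dμ_K > ∫‖∇P_K u‖² dμ_K + δ`; necessarily `N_K > K` (on level-`N` fields `P_K ⊇ P_N` is exact,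
`eGradNormSq_fourierTruncate_of_isLevel` + `Torus.freqBall_mono`), so `N_K → ∞` and the hypothesis
applies. Energy row at each level (`ensembleDissipation_eq_of_polyStationary`):
`E_i := ∫‖∇u‖²dμ_{φ i} = ∫(f,u)dμ_{φ i}/ν → ∫(f,u)dμ_∞/ν = ∫‖∇u‖²dμ_∞ =: E_∞ < ∞`. For fixed `K` and
`φ i ≥ K`, monotonicity of `K ↦ ‖∇P_K u‖²` gives `∫‖∇P_K u‖²dμ_{φ i} + δ < E_{i}`; letting `i → ∞`,
`∫‖∇P_K u‖²dμ_∞ + δ ≤ E_∞`; letting `K → ∞` (monotone convergence, `‖∇P_K u‖² ↑ ‖∇u‖²`),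
`E_∞ + δ ≤ E_∞ < ∞` — absurd. [difficulty: M] -/
theorem stub_scheduleOfLimitEnergyEq :
    ∀ (ν : ℝ) (f : UnitAddTorus (Fin 3) → EuclideanSpace ℝ (Fin 3)) (R : ℝ), 0 < ν → MemLp f 2 volume →
    (∀ (Nl : ℕ → ℕ) (μ : ℕ → Measure (Torus.energySpace (Fin 3))),
      (∀ i, IsProbabilityMeasure (μ i)) → (∀ i, ∀ᵐ u ∂(μ i), IsLevel (Nl i) u) →
      (∀ i, ∀ᵐ u ∂(μ i), ‖u‖ ≤ R) → (∀ i (d : ℕ), IsPolyStationary ν f (Nl i) d (μ i)) →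
      Tendsto Nl atTop atTop →
      ∃ φ : ℕ → ℕ, StrictMono φ ∧ ∃ μlim : Measure (Torus.energySpace (Fin 3)),
        Torus.ensembleEnstrophy μlim ≠ ⊤ ∧
        ν * (Torus.ensembleEnstrophy μlim).toReal = ∫ u, Torus.pairing u.1 f ∂μlim ∧
        Tendsto (fun i => ∫ u, Torus.pairing u.1 f ∂(μ (φ i))) atTop
          (𝓝 (∫ u, Torus.pairing u.1 f ∂μlim)) ∧
        (∀ K : ℕ, Tendsto (fun i => ∫⁻ u, Torus.eGradNormSq (Torus.fourierTruncate K
            (u.1 : UnitAddTorus (Fin 3) → EuclideanSpace ℝ (Fin 3))) ∂(μ (φ i))) atTop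
          (𝓝 (∫⁻ u, Torus.eGradNormSq (Torus.fourierTruncate K
            (u.1 : UnitAddTorus (Fin 3) → EuclideanSpace ℝ (Fin 3))) ∂μlim)))) →
    ∃ κ : ℕ → ℕ, ∀ (N : ℕ) (μ : Measure (Torus.energySpace (Fin 3))), IsProbabilityMeasure μ →
      (∀ᵐ u ∂μ, IsLevel N u) → (∀ᵐ u ∂μ, ‖u‖ ≤ R) → (∀ d : ℕ, IsPolyStationary ν f N d μ) →
      ∀ n : ℕ, ∫⁻ u, Torus.eGradNormSq (u.1 : UnitAddTorus (Fin 3) → EuclideanSpace ℝ (Fin 3)) ∂μ ≤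
        (∫⁻ u, Torus.eGradNormSq (Torus.fourierTruncate (κ n)
          (u.1 : UnitAddTorus (Fin 3) → EuclideanSpace ℝ (Fin 3))) ∂μ) + ((n : ℝ≥0∞) + 1)⁻¹ :=
  Summit.AnomalousDissipation.AnomalousDissipation.Theorems.MomentParityResolvedDissipation.Schedule.stub_scheduleOfLimitEnergyEq

/-! ## Glue lemmas (PROVED): the `N`-uniform enstrophy budget and lsc of the stress functional -/

/-- **The `N`-uniform enstrophy budget of admissible laws** (energy row + Cauchy–Schwarz, Disproof §6
re-derived over the landed vocabulary): `∫⁻ ‖∇u‖² dμ ≤ ‖f‖₂ R / ν` for every admissible law at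
`(f, ν, R)`, whatever the level `N`. This is where `0 < ν` enters the line
(`resolvedDissipation_false_without_nu_pos`). [folklore] -/
theorem ensembleEnstrophy_le_budget {ν : ℝ} (hν : 0 < ν)
    {f : UnitAddTorus (Fin 3) → EuclideanSpace ℝ (Fin 3)} (hf : MemLp f 2 volume) {N : ℕ}
    {μ : Measure (Torus.energySpace (Fin 3))} (hp : IsProbabilityMeasure μ)
    (hlev : ∀ᵐ u ∂μ, IsLevel N u) {R : ℝ} (hR : ∀ᵐ u ∂μ, ‖u‖ ≤ R)
    (hstat : ∀ d : ℕ, IsPolyStationary ν f N d μ) :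
    Torus.ensembleEnstrophy μ ≤ ((Real.sqrt (∫ x, ‖f x‖ ^ 2) * R / ν).toNNReal : ℝ≥0∞) := by
  haveI : (ae μ).NeBot := ae_neBot.2 (IsProbabilityMeasure.ne_zero μ)
  obtain ⟨u₀, hu₀⟩ := hR.exists
  have hR0 : 0 ≤ R := (norm_nonneg _).trans hu₀
  have h2 : Integrable (fun u : Torus.energySpace (Fin 3) => ‖u‖ ^ 2) μ :=
    Integrable.of_bound (continuous_norm.pow 2).aestronglyMeasurable (R ^ 2) (hR.mono fun u hu => by
      rw [Real.norm_eq_abs, abs_of_nonneg (by positivity)]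
      exact pow_le_pow_left₀ (norm_nonneg _) hu 2)
  -- mean energy `≤ R²`
  have hE : Torus.ensembleEnergy μ ≤ R ^ 2 := by
    unfold Torus.ensembleEnergy
    calc ∫ u, ‖u‖ ^ 2 ∂μ ≤ ∫ _u, R ^ 2 ∂μ := integral_mono_ae h2 (integrable_const _)
          (hR.mono fun u hu => pow_le_pow_left₀ (norm_nonneg _) hu 2)
      _ = R ^ 2 := by simp
  -- power ceiling `ν ∫‖∇u‖² ≤ ‖f‖₂ R` from the energy row (3-stationarity suffices)
  have hdiss : Torus.ensembleDissipation ν μ ≤ Real.sqrt (∫ x, ‖f x‖ ^ 2) * R := by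
    rw [ensembleDissipation_eq_of_polyStationary f hf hlev h2 le_rfl (hstat 3)]
    refine (Theorems.CubicParityLoud.Negative.integral_pairing_le hf h2).trans ?_
    gcongr
    calc Real.sqrt (Torus.ensembleEnergy μ) ≤ Real.sqrt (R ^ 2) := Real.sqrt_le_sqrt hE
      _ = R := Real.sqrt_sq hR0
  -- finiteness of the mean enstrophy of a level-`N` law in the ball
  have hne : Torus.ensembleEnstrophy μ ≠ ⊤ := by
    have h1 := ensembleEnstrophy_le_of_level hlev
    have h3 : ∫⁻ u : Torus.energySpace (Fin 3), ‖u‖ₑ ^ 2 ∂μ ≤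
        ∫⁻ _u : Torus.energySpace (Fin 3), ENNReal.ofReal (R ^ 2) ∂μ :=
      lintegral_mono_ae (hR.mono fun u hu => by
        rw [← ofReal_norm, ← ENNReal.ofReal_pow (norm_nonneg _)]
        exact ENNReal.ofReal_le_ofReal (pow_le_pow_left₀ (norm_nonneg _) hu 2))
    rw [lintegral_const, measure_univ, mul_one] at h3
    exact ne_top_of_le_ne_top
      (ENNReal.mul_ne_top ENNReal.ofReal_ne_top (ne_top_of_le_ne_top ENNReal.ofReal_ne_top h3)) h1
  unfold Torus.ensembleDissipation at hdiss
  rw [← ENNReal.ofReal_toReal hne]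
  refine ENNReal.ofReal_le_ofReal ?_
  rw [le_div_iff₀ hν, mul_comm]
  exact hdiss

/-- **The squared Reynolds-stress functional `u ↦ ‖B(u,u)‖²_{V′}` is lower semicontinuous on `H`**
(norm topology): a supremum of the norm-continuous quadratic forms `u ↦ |∫(u⊗u):∇w|`
(`Torus.continuous_inertialPairing_coe`), squared. This is what lets K1 pass to Galerkin limits. [folklore] -/
theorem lowerSemicontinuous_stressSq :
    LowerSemicontinuous fun u : Torus.energySpace (Fin 3) =>
      (⨆ (w : UnitAddTorus (Fin 3) → EuclideanSpace ℝ (Fin 3))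
          (_ : Torus.IsSmooth w ∧ Torus.IsDivFree w ∧ Torus.HasZeroMean w ∧ Torus.eGradNormSq w ≤ 1),
          ‖Torus.inertialPairing u.1 w‖ₑ) ^ 2 := by
  have h1 : LowerSemicontinuous fun u : Torus.energySpace (Fin 3) =>
      ⨆ (w : UnitAddTorus (Fin 3) → EuclideanSpace ℝ (Fin 3))
        (_ : Torus.IsSmooth w ∧ Torus.IsDivFree w ∧ Torus.HasZeroMean w ∧ Torus.eGradNormSq w ≤ 1),
        ‖Torus.inertialPairing u.1 w‖ₑ :=
    lowerSemicontinuous_biSup fun w hw =>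
      ((Torus.continuous_inertialPairing_coe hw.1).enorm).lowerSemicontinuous
  exact (ENNReal.continuous_pow 2).comp_lowerSemicontinuous h1 fun a b hab => by dsimp only; gcongr

/-- **The maximal Galerkin flux `Π*(u) = sup_m |Π_m(u)|` is lower semicontinuous on `H`** (a supremum of
the continuous `|Π_m|`, L′). This is what lets K1′ pass to Galerkin limits. [folklore] -/
theorem lowerSemicontinuous_maximalFlux :
    LowerSemicontinuous fun u : Torus.energySpace (Fin 3) =>
      ⨆ m : ℕ, ‖Torus.inertialPairing u.1 (Torus.fourierTruncate m
          (u.1 : UnitAddTorus (Fin 3) → EuclideanSpace ℝ (Fin 3)))‖ₑ :=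
  lowerSemicontinuous_iSup fun m => ((stub_continuous_flux m).enorm).lowerSemicontinuous

/-! ## The composition (kernel-checked, no `sorry` of its own) -/

/-- **`ResolvedDissipation` from the stubs of v3** (concludes the route decl BY NAME). Fix `(f, ν, R)`;
K1′ gives `C`; to apply K2c take any admissible sequence at levels `N_i → ∞`: the budget
`ensembleEnstrophy_le_budget` feeds K2a, which extracts `φ`, `μ_∞` (probability, in the ball,
bounded-continuous convergence, lsc portmanteau, truncated-enstrophy and pairing continuity); K2b along
the subsequence makes `μ_∞` a stationary statistical solution; by `lowerSemicontinuous_maximalFlux` (L′)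
and K2a's lsc clause the mean maximal flux of `μ_∞` is `≤ liminf ≤ C < ∞`, so `g = Π*.toReal` is ONE
integrable function dominating every flux a.e. and P1′ gives the mean energy equality; K2c returns the
schedule `κ`, and the crux's verbatim clauses are the landed vocabulary by definitional unfolding. -/
theorem ResolvedDissipation_of : ResolvedDissipation := by
  intro f hf hdiv hzero ν hν R
  have hfL2 : MemLp f 2 volume := hf.memLp 2
  obtain ⟨C, hC⟩ := stub_uniformMaximalFlux f hf hdiv hzero ν hν R
  -- the `N`-uniform enstrophy budget of admissible laws at `(f, ν, R)`
  set M : ℝ≥0 := (Real.sqrt (∫ x, ‖f x‖ ^ 2) * R / ν).toNNReal with hM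
  -- the maximal flux and its measurability
  set Pstar : Torus.energySpace (Fin 3) → ℝ≥0∞ := fun u =>
    ⨆ m : ℕ, ‖Torus.inertialPairing u.1 (Torus.fourierTruncate m
      (u.1 : UnitAddTorus (Fin 3) → EuclideanSpace ℝ (Fin 3)))‖ₑ with hPstar
  have hPlsc : LowerSemicontinuous Pstar := lowerSemicontinuous_maximalFlux
  have hPmeas : Measurable Pstar := hPlsc.measurable
  -- K2c, fed by K2a + K2b + L′ + K1′ + P1′ along every admissible sequence with levels escaping to infinity
  obtain ⟨κ, hκ⟩ := stub_scheduleOfLimitEnergyEq ν f R hν hfL2 (by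
    intro Nl μ hp hl hb hs hN
    obtain ⟨φ, hφ, μlim, hplim, hblim, hBC, hLSC, hTE, hPI⟩ :=
      stub_tightExtraction R M μ hp hb fun i =>
        ensembleEnstrophy_le_budget hν hfL2 (hp i) (hl i) (hb i) (hs i)
    have hSSS : Torus.IsStationaryStatisticalSolution ν f μlim :=
      stub_limitIsStationarySolution ν f R hν hfL2 (fun i => Nl (φ i)) (fun i => μ (φ i))
        (fun i => hp (φ i)) (fun i => hl (φ i)) (fun i => hb (φ i)) (fun i d => hs (φ i) d)
        (hN.comp hφ.tendsto_atTop) μlim hplim hblim hBC hLSC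
    -- the mean maximal flux of the limit is finite
    have hfin : ∫⁻ u, Pstar u ∂μlim ≠ ⊤ := by
      have hlim : Filter.liminf (fun i => ∫⁻ u, Pstar u ∂(μ (φ i))) atTop ≤ (C : ℝ≥0∞) :=
        Filter.liminf_le_of_frequently_le'
          (Frequently.of_forall fun i => hC _ _ (hp (φ i)) (hl (φ i)) (hb (φ i)) (hs (φ i)))
      exact ne_top_of_le_ne_top (b := (C : ℝ≥0∞)) ENNReal.coe_ne_top ((hLSC _ hPlsc).trans hlim)
    -- ONE integrable dominating function for all fluxes: `g = Π*.toReal`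
    have hdom : ∃ g : Torus.energySpace (Fin 3) → ℝ, Integrable g μlim ∧
        ∀ m : ℕ, ∀ᵐ u ∂μlim, |Torus.inertialPairing u.1 (Torus.fourierTruncate m
          (u.1 : UnitAddTorus (Fin 3) → EuclideanSpace ℝ (Fin 3)))| ≤ g u := by
      refine ⟨fun u => (Pstar u).toReal, integrable_toReal_of_lintegral_ne_top hPmeas.aemeasurable hfin,
        fun m => ?_⟩
      filter_upwards [ae_lt_top hPmeas hfin] with u hu
      have h1 : ‖Torus.inertialPairing u.1 (Torus.fourierTruncate m
          (u.1 : UnitAddTorus (Fin 3) → EuclideanSpace ℝ (Fin 3)))‖ₑ ≤ Pstar u := by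
        rw [hPstar]
        exact le_iSup (fun m : ℕ => ‖Torus.inertialPairing u.1 (Torus.fourierTruncate m
          (u.1 : UnitAddTorus (Fin 3) → EuclideanSpace ℝ (Fin 3)))‖ₑ) m
      have h2 := ENNReal.toReal_mono hu.ne h1
      rwa [Real.enorm_eq_ofReal_abs, ENNReal.toReal_ofReal (abs_nonneg _)] at h2
    exact ⟨φ, hφ, μlim, hSSS.enstrophy_finite.ne,
      stub_energyEq_of_dominatedFlux ν f μlim hSSS hfL2 hdom, hPI f hfL2, hTE⟩)
  exact ⟨κ, fun N μ hp hl hb hs n => hκ N μ hp hl hb (fun d m g P hg _ => hs m g P hg) n⟩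

/-! ## The v2 composition, kept: `ResolvedDissipation` from the Reynolds-stress moment (K1 as hypothesis) -/

/-- **The v1–v2 line, sorry-free as a CONDITIONAL**: an `N`-uniform second moment of the Reynolds-stress
dual norm `‖B(u,u)‖_{V′} = sup {|∫(u⊗u):∇w| : w ∈ 𝒱, ‖∇w‖₂ ≤ 1}` over admissible laws at `(f, ν, R)` (the
planner's hard stub K1, budget 3/2) implies the crux's conclusion at `(f, ν, R)`: budget → K2a → K2b →
(`lowerSemicontinuous_stressSq` + lsc clause + the bound ⇒ finite stress moment of the limit) → P1 (landed,
`StressEnergyEq.stub_energyEq_of_stressMoment`) → K2c. -/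
theorem resolvedAt_of_uniformStressMoment {f : UnitAddTorus (Fin 3) → EuclideanSpace ℝ (Fin 3)}
    (hf : Torus.IsSmooth f) {ν : ℝ} (hν : 0 < ν) {R : ℝ} {C : ℝ≥0}
    (hC : ∀ (N : ℕ) (μ : Measure (Torus.energySpace (Fin 3))), IsProbabilityMeasure μ →
      (∀ᵐ u ∂μ, IsLevel N u) → (∀ᵐ u ∂μ, ‖u‖ ≤ R) → (∀ d : ℕ, IsPolyStationary ν f N d μ) →
      ∫⁻ u, (⨆ (w : UnitAddTorus (Fin 3) → EuclideanSpace ℝ (Fin 3))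
          (_ : Torus.IsSmooth w ∧ Torus.IsDivFree w ∧ Torus.HasZeroMean w ∧ Torus.eGradNormSq w ≤ 1),
          ‖Torus.inertialPairing u.1 w‖ₑ) ^ 2 ∂μ ≤ C) :
    ∃ κ : ℕ → ℕ, ∀ (N : ℕ) (μ : Measure (Torus.energySpace (Fin 3))), IsProbabilityMeasure μ →
      (∀ᵐ u ∂μ, IsLevel N u) → (∀ᵐ u ∂μ, ‖u‖ ≤ R) → (∀ d : ℕ, IsPolyStationary ν f N d μ) →
      ∀ n : ℕ, ∫⁻ u, Torus.eGradNormSq (u.1 : UnitAddTorus (Fin 3) → EuclideanSpace ℝ (Fin 3)) ∂μ ≤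
        (∫⁻ u, Torus.eGradNormSq (Torus.fourierTruncate (κ n)
          (u.1 : UnitAddTorus (Fin 3) → EuclideanSpace ℝ (Fin 3))) ∂μ) + ((n : ℝ≥0∞) + 1)⁻¹ := by
  have hfL2 : MemLp f 2 volume := hf.memLp 2
  set M : ℝ≥0 := (Real.sqrt (∫ x, ‖f x‖ ^ 2) * R / ν).toNNReal with hM
  refine stub_scheduleOfLimitEnergyEq ν f R hν hfL2 ?_
  intro Nl μ hp hl hb hs hN
  obtain ⟨φ, hφ, μlim, hplim, hblim, hBC, hLSC, hTE, hPI⟩ :=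
    stub_tightExtraction R M μ hp hb fun i =>
      ensembleEnstrophy_le_budget hν hfL2 (hp i) (hl i) (hb i) (hs i)
  have hSSS : Torus.IsStationaryStatisticalSolution ν f μlim :=
    stub_limitIsStationarySolution ν f R hν hfL2 (fun i => Nl (φ i)) (fun i => μ (φ i))
      (fun i => hp (φ i)) (fun i => hl (φ i)) (fun i => hb (φ i)) (fun i d => hs (φ i) d)
      (hN.comp hφ.tendsto_atTop) μlim hplim hblim hBC hLSC
  have hfin : ∫⁻ u, (⨆ (w : UnitAddTorus (Fin 3) → EuclideanSpace ℝ (Fin 3))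
      (_ : Torus.IsSmooth w ∧ Torus.IsDivFree w ∧ Torus.HasZeroMean w ∧ Torus.eGradNormSq w ≤ 1),
      ‖Torus.inertialPairing u.1 w‖ₑ) ^ 2 ∂μlim ≠ ⊤ := by
    have hlim : Filter.liminf (fun i => ∫⁻ u, (⨆ (w : UnitAddTorus (Fin 3) → EuclideanSpace ℝ (Fin 3))
        (_ : Torus.IsSmooth w ∧ Torus.IsDivFree w ∧ Torus.HasZeroMean w ∧ Torus.eGradNormSq w ≤ 1),
        ‖Torus.inertialPairing u.1 w‖ₑ) ^ 2 ∂(μ (φ i))) atTop ≤ (C : ℝ≥0∞) :=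
      Filter.liminf_le_of_frequently_le'
        (Frequently.of_forall fun i => hC _ _ (hp (φ i)) (hl (φ i)) (hb (φ i)) (hs (φ i)))
    exact ne_top_of_le_ne_top (b := (C : ℝ≥0∞)) ENNReal.coe_ne_top
      ((hLSC _ lowerSemicontinuous_stressSq).trans hlim)
  exact ⟨φ, hφ, μlim, hSSS.enstrophy_finite.ne, stub_energyEq_of_stressMoment ν f μlim hSSS hfL2 hfin,
    hPI f hfL2, hTE⟩

end Summit.AnomalousDissipation.AnomalousDissipation.Cruxes.ResolvedDissipation.LionsL4Domination

end
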